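import Mathlib
import HarnessLib
import HarnessLib.Audit
import Summits.NavierStokesRegularity.Statement
import Literature.Analysis.FluidPDE.LocalTypeI
import Literature.Analysis.FluidPDE.KatoMaximalTime
import Summits.NavierStokesRegularity.NavierStokesRegularity.Theorems.AmplitudeIndexKatoToClay
import HarnessLib.Audit.Status.Attr

/-!
Route: MarginalTypeI

DORMANT since 2026-09-01T11:43:23Z (reconciler: no traction for 5 d (last activity statement-closed at 2026-08-27T10:58:52Z); parked, not closed — `ledger route dormant route-NavierStokesRegularity-MarginalTypeI --off` to reactivate) — unstaffed, not closed; items shared with open routes are served there. `ledger route dormant <id> --off` reactivates.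

Route MarginalTypeI — realises idea card threshold-marginal-blowup-dichotomy (and absorbs the
Choptuik/critical-collapse dictionary of its retired duplicate edge-tracking-critical-solution).
THESIS X ("it suffices to show X"): X = MarginalBlowupTypeI ∧ NoTypeIAncient (decl Thesis = their
conjunction; all decls elaborate, Sketch.lean rc 0).
(C1, rank 2) MarginalBlowupTypeI — "the first singularity met as viscosity is lowered is Type I":
for every ν>0 and every Clay datum u₀ (C^∞, div-free, rapidly decaying) sitting at its CRITICAL
VISCOSITY — Literature.Analysis.FluidPDE.HasGlobalKatoSolution ν' u₀ for all ν'>ν but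
¬HasGlobalKatoSolution ν u₀; by the in-tree hasGlobalKatoSolution_smul_iff this is exactly the
card's amplitude threshold A_c=1 on the ray A•u₀ (the blow-up is a limit from below of GLOBAL
solutions, i.e. marginal) — every Kato solution u on [0,T) (IsKatoSolutionOn T ν u₀ u) has, at every
x₀, some r₀>0 with ⨆ over parabolic sub-balls Q_r(z) ⊆ Q_{r₀}(T,x₀) of cknC r z u (= r⁻²∫∫|u|³) < ⊤:
a marginal blow-up is Type I in the scaled-L³ sense of Seregin2006/AlbrittonBarker2019 (content only
at T = T_max).
(C3, rank 3) NoTypeIAncient = (L′) in measurable-slice form: ¬∃ (u,p,G): slices u t a.e.-strongly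
measurable (t<0) ∧ IsBoundedAncientMildSolution 1 u ∧ suitable weak on slab (−∞,0)×ℝ³ ∧ weak
gradient G ∧ u ≠ 0 a.e. ∧ typeIBound (Iio 0 ×ˢ univ) u p G < ⊤. It is verbatim the statement refuted
from KNSS (L) in tree (LiouvilleConjectureNS.not_nontrivialMildAncientTypeIExists_measurable), hence
a one-line consequence of route TypeILiouville's crux stmt-0057 if that lands, but strictly weaker
than (L).
DECIDING THEOREM (D-0027 §2.1; rev 3 — the Assembly item is restated by decl names as exactly its
type and closes by `exact closes`): `closes (h₁ : MarginalBlowupTypeI) (h₃ : NoTypeIAncient) (hcv :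
CriticalViscosityExists) (hext : LocalTypeIExtraction) (hab : ABForwardMeasurable) (hclay :
KatoToClay) : NavierStokesRegularity`, PROVED sorry-free in the route file (native check ok, axioms
propext/Classical.choice/Quot.sound). Proof: for ν > 0 and a Clay datum u₀ either
HasGlobalKatoSolution ν u₀ — then KatoToClay (verbatim the tree fact
clay_solution_of_hasGlobalKatoSolution, discharged by clay_solution_of_hasGlobalKatoSolution_holds)
yields the Clay solution — or CriticalViscosityExists moves the same datum to its critical viscosity
ν_c ≥ ν, C1 gives the scaled Type-I bound there, LocalTypeIExtraction turns "no global Kato solution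
+ bound" into a local Type-I singular point (∃ r₀ z u p, IsLocalTypeISingularPoint r₀ z u p —
Literature.Analysis.FluidPDE.LocalTypeISingularityExists written out, so that the OPEN existence
statement is an intermediate proposition and not a named dependency of the route),
ABForwardMeasurable (AlbrittonBarker2019 Thm 1.1, forward) gives a nontrivial Type-I ancient mild
solution with measurable slices, contradicting C3.
Lean: MarginalBlowupTypeI ∧ NoTypeIAncient (decl Thesis = the two statements written out and
conjoined; Iff.rfl with C1 ∧ C3).

Rationale: WHY THIS LINE. Route TypeILiouville needs NoTypeII (stmt-0056: EVERY blow-up from Clay data is Type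
I); this route replaces it by a statement about ONE distinguished blow-up per datum: the one at the
critical viscosity ν_c = sup{ν': no global Kato solution} (= the card's amplitude threshold A_c on
the ray A•u₀, same thing by hasGlobalKatoSolution_smul_iff, KatoViscosityScaling.lean). That blow-up
is MARGINAL — a limit of global smooth solutions (GallagherIftimiePlanchon2003 Thm 3.1-3.2: the
global set is open) — and codimension-one threshold dynamics is the mildest in every model where it
is understood: radial supercritical heat, threshold ⇒ Type I (MatanoMerle2011); focusing semilinear
waves, threshold = stable manifold of a self-similar solution (BizoChmajTabor2004); gravitational
critical collapse, the critical solution at the black-hole threshold is universally (discretely)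
self-similar with one unstable mode (GundlachMartingarcia2007 §2-3). Dictionary (checkable): family
parameter p ↦ 1/ν (Reynolds number); threshold p* ↦ 1/ν_c; critical solution ↦ the Kato solution of
u₀ at ν_c up to T_max; "self-similar critical solution" ↦ scaled-L³ Type I bound (C1); sub-critical
echoing-then-dispersal ↦ the card's survived bursts. Imported areas: threshold/critical phenomena
(parabolic & dispersive PDE, numerical GR) for the heuristics; Seregin–Šverák/Albritton–Barker
Type-I calculus and Kato L³ theory (all in tree) for the rigorous frame. The frame is in-tree and
largely PROVED (clay_solution_of_hasGlobalKatoSolution_holds, kato_local_holds, kato_unique_holds,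
singular_point_of_not_hasGlobalKatoSolution, exists_rieszPressure_suitable_slab,
localTypeISingularityExists_of_nontrivialMildAncientTypeIExists); the deciding theorem `closes` is
proved in the route file (rev 3).
RANKED CRUXES. #2 MarginalBlowupTypeI (all the difficulty; why it might fail: a Type-II mechanism
robust enough to sit on the codimension-one boundary of the global set; Tao's averaged blow-up is
Type II (Tao2016AveragedNS p.8) so no averaging-insensitive proof exists; free families of global
solutions DO carry arbitrarily concentrated bursts by grafting rescaled large global solutions
(refuter audit; CheminGallagherPaicu2011) — only the threshold structure can forbid them). #3
NoTypeIAncient (L′) (why it might fail: one backward-DSS Type-I profile refutes it —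
TypeIDSSLiouvilleConjecture open, barrier TruncatedDyadicTypeIBlowup shows Type-I blow-up in an
averaging-class model; known cases: axisymmetric (SereginSverak2009, Seregin2020), under (L) (in
tree)). Support (rank 9, known-result chains; none is a crux): KatoToClay (= the PROVED tree fact
clay_solution_of_hasGlobalKatoSolution verbatim; one-line discharge from NSKatoToClayHolds.lean in a
Theorems file — shared with route AmplitudeIndex, stmt-NavierStokesRegularity-10568),
CriticalViscosityExists (sSup + fujita_kato_global_small_holds + GIP2003 openness — the one
ingredient NOT in tree, cite item filed), LocalTypeIExtraction (rev 3: conclusion written as ∃ r₀ z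
u p, IsLocalTypeISingularPoint r₀ z u p, i.e. LocalTypeISingularityExists unfolded, Iff.rfl; chain:
singular_point_of_not_hasGlobalKatoSolution with the named facts
continuation_of_bounded/farField_bound = Lemarierieusset2023 Thm 15.1, BOTH NOW PROVED in tree
(RusinSverakSingularPointProofs, KatoFarFieldBound), kato_local_holds; Seregin2006 Lemma 2.1(b): sup
C bounded ⇒ A+D₀+E bounded; Riesz-pressure suitability; ν→1 time-rescaling with a covering of
anisotropic cylinders), ABForwardMeasurable (rev 3: hypothesis written as the same ∃ r₀ z u p,
IsLocalTypeISingularPoint …; = named fact AlbrittonBarkerForward — UNPROVED, needs-fact — plus slice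
measurability of the smooth KNSS limit, SereginSverak2009 Thm 2.4).
NUMBERS. Items at open: 7 (target, assembly, 2 cruxes, 3 support); rev 3: 8 (target, assembly
restated by decl names = type of `closes`, 2 cruxes, 4 support: + KatoToClay); decl-cone rev 3: 54
project constants, 0 unproved closed facts (imports LocalTypeI + KatoMaximalTime only); new
definitions: 0; cite requests: 1 (GIP2003 openness in L³/Ḣ^{1/2}). Known cases of C1's conclusion: 0
beyond the vacuous (no blow-up known); known cases of C3: axisymmetric (Seregin2020), |u|≤C/|x'|
(KNSS2009 Thm 5.3), under (L).
KILL CRITERIA. (i) A Kato solution from Clay data at its critical viscosity with a Type-II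
(unbounded scaled L³) singularity refutes C1 — that is ¬Clay(A) outright; close refuted. (ii)
NontrivialMildAncientTypeIExists with measurable slices (e.g. a backward DSS profile, cf. route
Blowup crux #5) refutes C3 — pivot: restrict C3 to ancient solutions that are limits of MARGINAL
blow-ups (eternal, forward-global Type-I bound), else close. (iii) Cheap test (numerics-facing, not
an item): on Hou's axisymmetric ray (Hou2022PotentiallySingularNS) C1 ∧ Seregin2020 predict NO
critical viscosity, so the small-scale scaled L³ below the apparent threshold must diverge rather
than saturate; saturation at a genuine threshold would refute C1.
COROLLARY WITH TEETH. C1 ∧ CriticalViscosityExists ∧ Seregin2020 (axisymmetric energy solutions have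
no scaled-Type-I blow-up) ⇒ axisymmetric Clay data have global Kato solutions for every ν (an
AxisymmetricSwirlRegularity-type statement): the crux specialised to axisymmetry already carries the
axisymmetric-with-swirl problem.
TWO-LAYER PLAN (D-0019). Layer 1 now: C1, C3 + four support chains + the proved deciding theorem
`closes`. Layer 2 only after a crux moves: C1 ⇐ {family form ¬β of the card (uniform bound along
ν'↓ν_c at all times) → C1 by continuous dependence + l.s.c.; compactness of the burst locus at
(T_max,x₀); local-energy export inequality for survived bursts}; C3 ⇐ {DSS case, recurrent case}
shared with cards recurrent-type-i-profiles / discrete-stabiliser-dimension-count.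
NOT DECOMPOSED (deliberately). How C1 is proved (no mechanism in hand beyond codimension-one
heuristics — flagged by card and audit); the card's stronger family statement ¬β (survived
Euler-scaling bursts at ALL times, incl. after T_max) — not needed by the assembly, kept as the
numerics test; the eternal max-normalised limit objects; no finer target than Thesis = C1 ∧ C3.
CHEAPEST FALSIFIER. For C3: exhibit ONE nontrivial mild bounded ancient solution with 𝐈 < ∞ and
measurable slices — the cheapest candidates are backward discretely-self-similar Type-I profiles
(TypeIDSSLiouvilleConjecture; barrier TruncatedDyadicTypeIBlowup shows the averaging-class analogue
exists), which refutes NoTypeIAncient outright. For C1: the numerics-facing test of KILL CRITERIA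
(iii) — on Hou's axisymmetric ray (Hou2022PotentiallySingularNS) C1 ∧ CriticalViscosityExists ∧
Seregin2020 predict NO critical viscosity, so saturation of the small-scale scaled L³ at a genuine
amplitude threshold refutes C1; formally, any Kato solution from Clay data at its critical viscosity
with unbounded scaled L³ (Type II) kills the route.

Novelty: NOVELTY (searched 2026-08-15 by this planner, on top of the card's audited searches
(refuter-novelty-audit-3: zbMATH 'minimal blow-up data Navier-Stokes', 'threshold solutions type I
supercritical heat', 'edge of chaos Navier-Stokes'; Poulon arXiv:1505.06197 pp.3-7)): `lit frontier
NavierStokesRegularity --since 2022` (30 rows; one namesake: arXiv:2605.01875/2605.01873 Shahmurov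
(May 2026) 'direct first-threshold continuation' = a stopping-TIME threshold of a concentration
score inside one solution, unrefereed global-regularity claim — different object, not an
amplitude/viscosity threshold across a family); `lit read doi:10.5802/aif.1983`
GallagherIftimiePlanchon2003 pp.1398-1399 (Thm 3.1/3.2 + 'the set of initial conditions for which a
global solution exists [is] open'; Remark 3.1: earlier H¹ (Ponce–Racke–Sideris–Titi 1994) and L³
stability results under a-priori decay assumptions); `lit read paper:arxiv-math_0607537` Seregin2006
p.4 Lemma 2.1(b); `lit read arXiv:2006.04140` Seregin2020 abstract ('axially symmetric energy
solutions have no Type I blowups', scaled-energy sense); zbMATH MatanoMerle2011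
(doi:10.1016/j.jfa.2011.02.025); `lit galaxy search --star all` for "threshold solution blows up
type I", "minimal blow-up data Navier-Stokes type I", "borderline blow-up" (0 hits) and `--star pdf`
"threshold solutions" (8 hits: critical collapse Baumgarte–Gundlach–Hilditch, NLS minimal blow-up
Raphaël–Szeftel — cross-field analogues only); in-tree scan of Literature/Analysis/Fl  [refs: 10.5802/aif.1983`, 10.1016/j.jfa.2011.02.025, 1505.06197, 2605.01875, 2006.04140, 0911.0500, 1012.0145, doi:10.5802/aif.1983, paper:arxiv-math_0607537, doi:10.1016/j.jfa.2011.02.025, GallagherIftimiePlanchon2003, Seregin2006, Seregin2020, MatanoMerle2011, RusinSverak2011, JiaSverak2013, GKP2016, KNSS2009, AlbrittonBarker2019, GundlachMartingarcia2007, BizoChmajTabor2004]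

Barriers (technique_class: amplitude-threshold-marginality type-I-scaled-energy): Literature.Barriers.NavierStokesRegularity.EnergySupercriticality: NOT evaded at the crux — C1 is a
critical (scale-invariant, cknC) a-priori bound to be won from supercritical data; the bet is the
extra structure of MARGINALITY (the blow-up is a codimension-one limit of global smooth solutions),
which 'every-solution' energy arguments cannot see; the frame itself never uses energy coercively
(finite energy enters only to put the Riesz pressure in L^{3/2} inside LocalTypeIExtraction).
Literature.Barriers.NavierStokesRegularity.TaoAveragedBlowup: conceded head-on (as on the card) —
averaged NS blows up, hence has critical viscosities, and its blow-up is Type II (Tao2016AveragedNS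
arXiv:1402.0290 p.8 footnote), so the averaged analogue of C1 is presumably FALSE; any proof of C1
must use NS-specific structure (true pressure + local energy inequality as in NRŠ/Tsai, backward
uniqueness EscauriazaSereginSverak2003, vorticity geometry) and cannot be an abstract bilinear-form
estimate.
Literature.Barriers.NavierStokesRegularity.TruncatedDyadicBlowup: same concession as for
TaoAveragedBlowup — the threshold frame (openness, sSup, Type-I extraction) is energy-class and
would transfer to Tao's averaged/truncated models, so it only relocates the difficulty into C1,
whose proof must use the autonomy and fine structure of true NS.
Literature.Barriers.NavierStokesRegularity.TruncatedDyadicTypeIBlowup: bites C3 = (L′) (a Type-I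
blow-up exists in an averaging-class dyadic model), so C3 needs

History (route lifecycle, newest last):
- 2026-08-15T17:00:53Z · rev 2: restated LocalTypeIExtraction (stmt-NavierStokesRegularity-1751), ABForwardMeasurable (stmt-NavierStokesRegularity-1752), Assembly (stmt-NavierStokesRegularity-1753) — route-repair (glue + cone), rev 3: (1) DECIDING THEOREM `closes : MarginalBlowupTypeI → NoTypeIAncient → CriticalViscosityExists → LocalTypeIExtr (planner-rbadge-NavierStokesRegularity-Marginal-b79362da-g2-0)
- 2026-08-22T18:34:08Z · DORMANT — reconciler: no traction for 5.6 d (last activity item-evidence-added at 2026-08-17T04:23:55Z); parked, not closed — `ledger route dormant route-NavierStokesRegu (operator:999:577514)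
- 2026-08-26T16:15:26Z · REACTIVATED — reconciler: reactivated — activity item-proof-filed at 2026-08-26T15:14:59Z after parking at 2026-08-22T18:34:08Z (operator:999:434001)
- 2026-09-01T11:43:23Z · DORMANT — reconciler: no traction for 5 d (last activity statement-closed at 2026-08-27T10:58:52Z); parked, not closed — `ledger route dormant route-NavierStokesRegularit (operator:999:3239570)

sub-problem: NavierStokesRegularity · status: dormant · opened planner-plancard-NavierStokesRegularity-Navie-d5b3a998-0 2026-08-15T10:58:21Z · rev 2 · ledger route-NavierStokesRegularity-MarginalTypeI
GENERATED by the gate from the ledger (D-0016/17). Provers cite these decls: `theorem foo : Summit.NavierStokesRegularity.NavierStokesRegularity.Theses.MarginalTypeI.<Decl> := …` in Summits/NavierStokesRegularity/NavierStokesRegularity/Theorems/<Name>.lean.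
-/

namespace Summit.NavierStokesRegularity.NavierStokesRegularity.Theses.MarginalTypeI

open scoped BigOperators Topology Manifold Classical MeasureTheory ProbabilityTheory Matrix InnerProductSpace ComplexConjugate ContinuousMap
open Filter Set Function TopologicalSpace MeasureTheory

attribute [summit_statement] _root_.NavierStokesRegularity

open Literature.NS

/-- item stmt-NavierStokesRegularity-1747 · target · rank 0 · open · by planner
why it might fail: C1 has no mechanism in hand: a Type-II cascade robust enough to sit on the codimension-one boundary of the global set (Tao's averaged blow-up IS Type II) falsifies X; C3 dies with one backward-DSS or recurrent Type-I ancient profile (TypeIDSSLiouvilleConjecture open).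
sources: MatanoMerle2011, Tao2016AveragedNS, AlbrittonBarker2019, KNSS2009, GallagherIftimiePlanchon2003
[target] X = MarginalBlowupTypeI ∧ NoTypeIAncient (card threshold-marginal-blowup-dichotomy): (C1)
at the critical viscosity ν_c of a Clay datum (global Kato solution for every ν'>ν_c, none at ν_c; =
amplitude threshold A_c=1 on the ray A•u₀ by hasGlobalKatoSolution_smul_iff) every Kato solution has
locally bounded scaled L³ (sup over parabolic sub-balls of cknC = r⁻²∫∫|u|³ finite near every
(T,x₀)) — marginal blow-up is Type I; (C3) no nontrivial mild bounded ancient solution (ν=1,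
measurable slices, suitable on (−∞,0)×ℝ³) with Albritton–Barker 𝐈 < ∞. [sources: MatanoMerle2011
(model), GallagherIftimiePlanchon2003 Thm 3.1-3.2, AlbrittonBarker2019 Thm 1.1, KNSS2009 §1 §6,
Seregin2006 Lemma 2.1] -/
@[route_item "route-NavierStokesRegularity-MarginalTypeI"]
def Thesis : Prop :=
  (∀ ν : ℝ, 0 < ν → ∀ u₀ : EuclideanSpace ℝ (Fin 3) → EuclideanSpace ℝ (Fin 3), ContDiff ℝ (⊤ : ℕ∞) u₀ → Literature.Analysis.FluidPDE.NSWave0.IsDivFree u₀ → Literature.Analysis.FluidPDE.HasRapidSpatialDecay u₀ → (∀ ν' : ℝ, ν < ν' → Literature.Analysis.FluidPDE.HasGlobalKatoSolution ν' u₀) → ¬ Literature.Analysis.FluidPDE.HasGlobalKatoSolution ν u₀ → ∀ (T : ℝ) (u : ℝ → EuclideanSpace ℝ (Fin 3) → EuclideanSpace ℝ (Fin 3)), 0 < T → Literature.Analysis.FluidPDE.IsKatoSolutionOn T ν u₀ u → ∀ x₀ : EuclideanSpace ℝ (Fin 3), ∃ r₀ : ℝ, 0 < r₀ ∧ (⨆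 (r : ℝ) (_ : 0 < r) (z : ℝ × EuclideanSpace ℝ (Fin 3)) (_ : Literature.Analysis.FluidPDE.parabolicCylinder r z ⊆ Literature.Analysis.FluidPDE.parabolicCylinder r₀ (T, x₀)), Literature.Analysis.FluidPDE.cknC r z u) < ⊤) ∧ (¬ ∃ (u : ℝ → EuclideanSpace ℝ (Fin 3) → EuclideanSpace ℝ (Fin 3)) (p : ℝ → EuclideanSpace ℝ (Fin 3) → ℝ) (G : ℝ → EuclideanSpace ℝ (Fin 3) → EuclideanSpace ℝ (Fin 3) →L[ℝ] EuclideanSpace ℝ (Fin 3)), (∀ t < 0, MeasureTheory.AEStronglyMeasurable (u t) MeasureTheory.volume) ∧ Literature.Analysis.FluidPDE.IsBoundedAncientMildSolution 1 u ∧ Literature.Analysis.FluidPDE.IsSuitableWeakSolutionOn (Literature.Analysis.FluidPDE.slab (EuclideanSpace ℝ (Fin 3)) (Set.Iio 0) isOpen_Iio) 1 0 u p ∧ Literature.Analysis.FluidPDE.HasWeakSpatialGradientOn (Literature.Analysis.FluidPDE.slab (EuclideanSpace ℝ (Fin 3)) (Set.Iio 0) isOpen_Iio) u G ∧ ¬ (Function.uncurry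 u =ᵐ[MeasureTheory.volume.restrict (Set.Iio (0 : ℝ) ×ˢ (Set.univ : Set (EuclideanSpace ℝ (Fin 3))))] 0) ∧ Literature.Analysis.FluidPDE.typeIBound (Set.Iio (0 : ℝ) ×ˢ (Set.univ : Set (EuclideanSpace ℝ (Fin 3)))) u p G < ⊤)

/-- item stmt-NavierStokesRegularity-1748 · crux · rank 2 · open · by planner
why it might fail: No mechanism in hand; a codimension-one Type-II mechanism would sit on the global set's boundary. Tao's averaged NS blows up at Type-II rate (arXiv:1402.0290 p.8), so the averaged analogue is presumably false: proof needs NS-specific structure. Free global families do carry concentrated bursts.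
sources: MatanoMerle2011, Tao2016AveragedNS, GallagherIftimiePlanchon2003, CheminGallagherPaicu2011, Seregin2006, Hou2022PotentiallySingularNS
[crux] MARGINAL BLOW-UP IS TYPE I (card threshold-marginal-blowup-dichotomy, branch ¬β ⇒ α in its
weakest assembly-sufficient form). For ν>0 and a Clay datum u₀ (C^∞, div-free, rapidly decaying) at
its CRITICAL VISCOSITY — HasGlobalKatoSolution ν' u₀ for all ν'>ν and ¬HasGlobalKatoSolution ν u₀
(equivalently amplitude threshold A_c = 1 on the ray A•u₀ at fixed ν,
KatoViscosityScaling.hasGlobalKatoSolution_smul_iff; the blow-up is a limit of GLOBAL smooth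
solutions, GIP2003 Thm 3.1) — every Kato solution u on [0,T) (in particular the one on [0,T_max))
has at every x₀ an r₀>0 with sup over parabolic sub-balls Q_r(z) ⊆ Q_{r₀}(T,x₀) of
C(r,z;u)=r⁻²∫∫_{Q_r(z)}|u|³ finite: Type I in the scaled sense of Seregin2006/AlbrittonBarker2019
(for T<T_max it is trivial, u being bounded on [T−r₀²,T]). Equivalent along the family to the card's
Galilean-invariant oscillation bound (telescoping means + uniform energy). Model theorems:
MatanoMerle2011 (radial supercritical NLH: threshold ⇒ Type I), BizoChmajTabor2004,
GundlachMartingarcia2007 (critical collapse: threshold solutions are self-similar, one unstable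
mode). Why it might fail: see why_might_fail; refutation = a Type-II singularity at a crit -/
@[route_item "route-NavierStokesRegularity-MarginalTypeI", crux]
def MarginalBlowupTypeI : Prop :=
  ∀ ν : ℝ, 0 < ν → ∀ u₀ : EuclideanSpace ℝ (Fin 3) → EuclideanSpace ℝ (Fin 3), ContDiff ℝ (⊤ : ℕ∞) u₀ → Literature.Analysis.FluidPDE.NSWave0.IsDivFree u₀ → Literature.Analysis.FluidPDE.HasRapidSpatialDecay u₀ → (∀ ν' : ℝ, ν < ν' → Literature.Analysis.FluidPDE.HasGlobalKatoSolution ν' u₀) → ¬ Literature.Analysis.FluidPDE.HasGlobalKatoSolution ν u₀ → ∀ (T : ℝ) (u : ℝ → EuclideanSpace ℝ (Fin 3) → EuclideanSpace ℝ (Fin 3)), 0 < T → Literature.Analysis.FluidPDE.IsKatoSolutionOn T ν u₀ u → ∀ x₀ : EuclideanSpace ℝ (Fin 3), ∃ r₀ : ℝ, 0 < r₀ ∧ (⨆ (r : ℝ) (_ : 0 < r) (z : ℝ × EuclideanSpace ℝ (Fin 3)) (_ : Literature.Analysis.FluidPDE.parabolicCylinder r z ⊆ Literature.Analysis.FluidPDE.parabolicCylinder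 r₀ (T, x₀)), Literature.Analysis.FluidPDE.cknC r z u) < ⊤

/-- item stmt-NavierStokesRegularity-1749 · crux · rank 3 · open · by planner
why it might fail: One nontrivial mild bounded ancient solution with AB-𝐈<∞ (backward DSS or recurrent Type-I profile) refutes it; TypeIDSSLiouvilleConjecture is open and the truncated dyadic model HAS Type-I blow-up (barrier TruncatedDyadicTypeIBlowup); known only axisymmetric (Seregin2020) and under KNSS (L).
sources: AlbrittonBarker2019, KNSS2009, SereginSverak2009, Seregin2020, Tao2016AveragedNS
[crux] (L′), measurable-slice form: there is no triple (u,p,G) with u t a.e.-strongly measurable for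
every t<0, u a mild bounded ancient solution of NS (ν=1) on ℝ³×(−∞,0) (IsBoundedAncientMildSolution
1 u), (u,p) suitable weak on the slab (−∞,0)×ℝ³, G a weak spatial gradient of u there, u not a.e.
zero, and Albritton–Barker's 𝐈(ℝ³×ℝ₋) = typeIBound (Iio 0 ×ˢ univ) u p G < ∞ (AlbrittonBarker2019
Thm 1.1 second bullet; LocalTypeI.lean NontrivialMildAncientTypeIExists plus the slice-measurability
clause). VERBATIM the statement proved from KNSS (L) in tree:
Literature.Analysis.FluidPDE.LiouvilleConjectureNS.not_nontrivialMildAncientTypeIExists_measurable —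
so TypeILiouville's crux stmt-0057 closes it in one line; strictly weaker than (L) (only
Type-I-bounded ancient solutions). Shared Liouville half with cards recurrent-type-i-profiles /
discrete-stabiliser-dimension-count. Why it might fail: see why_might_fail. -/
@[route_item "route-NavierStokesRegularity-MarginalTypeI", crux]
def NoTypeIAncient : Prop :=
  ¬ ∃ (u : ℝ → EuclideanSpace ℝ (Fin 3) → EuclideanSpace ℝ (Fin 3)) (p : ℝ → EuclideanSpace ℝ (Fin 3) → ℝ) (G : ℝ → EuclideanSpace ℝ (Fin 3) → EuclideanSpace ℝ (Fin 3) →L[ℝ] EuclideanSpace ℝ (Fin 3)), (∀ t < 0, MeasureTheory.AEStronglyMeasurable (u t) MeasureTheory.volume) ∧ Literature.Analysis.FluidPDE.IsBoundedAncientMildSolution 1 u ∧ Literature.Analysis.FluidPDE.IsSuitableWeakSolutionOn (Literature.Analysis.FluidPDE.slab (EuclideanSpace ℝ (Fin 3)) (Set.Iio 0) isOpen_Iio) 1 0 u p ∧ Literature.Analysis.FluidPDE.HasWeakSpatialGradientOn (Literature.Analysis.FluidPDE.slab (EuclideanSpace ℝ (Fin 3)) (Set.Iio 0) isOpen_Iio)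 u G ∧ ¬ (Function.uncurry u =ᵐ[MeasureTheory.volume.restrict (Set.Iio (0 : ℝ) ×ˢ (Set.univ : Set (EuclideanSpace ℝ (Fin 3))))] 0) ∧ Literature.Analysis.FluidPDE.typeIBound (Set.Iio (0 : ℝ) ×ˢ (Set.univ : Set (EuclideanSpace ℝ (Fin 3)))) u p G < ⊤

/-- item stmt-NavierStokesRegularity-10568 · support · rank 9 · closed · proved by Summit.NavierStokesRegularity.NavierStokesRegularity.Theorems.amplitudeIndex_katoToClay_proof (prover) · by planner
[support] KATO → CLAY bridge (hypothesis of the deciding theorem `closes`; provable now in ONE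
line): a smooth, divergence-free, rapidly decaying datum with a global Kato solution (C([0,∞);L³)
mild) has a jointly smooth bounded-energy Clay solution (u,p). VERBATIM the named fact
Literature.Analysis.FluidPDE.clay_solution_of_hasGlobalKatoSolution (NSKatoToClay.lean), DISCHARGED
in tree: `theorem … : KatoToClay :=
Literature.Analysis.FluidPDE.clay_solution_of_hasGlobalKatoSolution_holds` (NSKatoToClayHolds.lean;
Kato 1984 Thm 4, von Wahl / Lemarié-Rieusset 2016 Prop 12.3). Same signature as ThinOrFatPincer's
stmt-NavierStokesRegularity-8948 and MinimalBlowupRigidity's stmt-NavierStokesRegularity-0108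
(shared). The proved fact's file is deliberately NOT imported by the route (its import closure
carries unrelated named facts); the prover's Theorems file imports it. [difficulty: provable-now]
[sources: Kato1984, LemarieRieusset2016, FujitaKato1964] -/
@[route_item "route-NavierStokesRegularity-MarginalTypeI", crux]
def KatoToClay : Prop :=
  ∀ ν : ℝ, 0 < ν → ∀ u₀ : EuclideanSpace ℝ (Fin 3) → EuclideanSpace ℝ (Fin 3), ContDiff ℝ (⊤ : ℕ∞) u₀ → Literature.Analysis.FluidPDE.NSWave0.IsDivFree u₀ → Literature.Analysis.FluidPDE.HasRapidSpatialDecay u₀ → Literature.Analysis.FluidPDE.HasGlobalKatoSolution ν u₀ → ∃ (u : ℝ → EuclideanSpace ℝ (Fin 3) → EuclideanSpace ℝ (Fin 3)) (p : ℝ → EuclideanSpace ℝ (Fin 3) → ℝ), Literature.Analysis.FluidPDE.IsSmoothOnHalfSpace u ∧ Literature.Analysis.FluidPDE.IsSmoothOnHalfSpace p ∧ Literature.Analysis.FluidPDE.IsNavierStokesSolution ν 0 u₀ u p ∧ Literature.Analysis.FluidPDE.HasBoundedEnergy u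

/-- `KatoToClay` holds: proved by `Summit.NavierStokesRegularity.NavierStokesRegularity.Theorems.amplitudeIndex_katoToClay_proof`. -/
theorem KatoToClay_holds : KatoToClay := _root_.Summit.NavierStokesRegularity.NavierStokesRegularity.Theorems.amplitudeIndex_katoToClay_proof

-- earlier LocalTypeIExtraction (stmt-NavierStokesRegularity-1751, replaced 2026-08-15T17:00:53Z -> stmt-NavierStokesRegularity-11301): retired by None — ∀ ν : ℝ, 0 < ν → ∀ u₀ : EuclideanSpace ℝ (Fin 3) → EuclideanSpace ℝ (Fin 3), ContDiff ℝ (⊤ : ℕ∞) u₀ → Literature.Analysis.FluidPDE.NSWave0.IsDivFree u₀ → Literature.Analysis.FluidPDE.HasRapidSpatialDecay u₀ → ¬ Literature.Analysis.FluidPDE.HasGlobal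
/-- item stmt-NavierStokesRegularity-11301 · support · rank 9 · closed · proved by Summit.NavierStokesRegularity.NavierStokesRegularity.Theorems.marginalTypeI_localTypeIExtraction_proof (prover) · by planner
sources: Lemarierieusset2023, Seregin2006, RusinSverak2011, AlbrittonBarker2019
[support] TYPE-I EXTRACTION (card T2 + singular-point bookkeeping; known-result chain). REV 3
RESTATEMENT (definitional, Iff.rfl with rev 1): the conclusion
Literature.Analysis.FluidPDE.LocalTypeISingularityExists is WRITTEN OUT as ∃ r₀ z u p,
Literature.Analysis.FluidPDE.IsLocalTypeISingularPoint r₀ z u p, so that the OPEN existence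
statement (A–B Thm 1.1 first bullet, [status: open], never a _holds) is an intermediate proposition
of the route and not a named dependency. Content: a Clay datum without global Kato solution at ν
whose Kato solutions obey the local scaled-L³ bound of MarginalBlowupTypeI yields a suitable weak
solution with a local Type-I singular point (IsLocalTypeISingularPoint: suitable in a parabolic
ball, backward singular centre, 𝐈 of the ball finite). Chain:
singular_point_of_not_hasGlobalKatoSolution (RusinSverakSingularPoint.lean; its named-fact inputs
IsKatoSolutionOn.continuation_of_bounded and IsKatoSolutionOn.farField_bound = Lemarierieusset2023
Thm 15.1(C) are now PROVED in tree: RusinSverakSingularPointProofs, KatoFarFieldBound;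
kato_local_holds) gives the Kato solution on [0,T_max) and a backward singular point (T_max,x_*);
the hypothesis gives sup over -/
@[route_item "route-NavierStokesRegularity-MarginalTypeI", crux]
def LocalTypeIExtraction : Prop :=
  ∀ ν : ℝ, 0 < ν → ∀ u₀ : EuclideanSpace ℝ (Fin 3) → EuclideanSpace ℝ (Fin 3), ContDiff ℝ (⊤ : ℕ∞) u₀ → Literature.Analysis.FluidPDE.NSWave0.IsDivFree u₀ → Literature.Analysis.FluidPDE.HasRapidSpatialDecay u₀ → ¬ Literature.Analysis.FluidPDE.HasGlobalKatoSolution ν u₀ → (∀ (T : ℝ) (u : ℝ → EuclideanSpace ℝ (Fin 3) → EuclideanSpace ℝ (Fin 3)), 0 < T → Literature.Analysis.FluidPDE.IsKatoSolutionOn T ν u₀ u → ∀ x₀ : EuclideanSpace ℝ (Fin 3), ∃ r₀ : ℝ, 0 < r₀ ∧ (⨆ (r : ℝ) (_ : 0 < r) (z : ℝ × EuclideanSpace ℝ (Fin 3)) (_ : Literature.Analysis.FluidPDE.parabolicCylinder r z ⊆ Literature.Analysis.FluidPDE.parabolicCylinder r₀ (T, x₀)), Literature.Analysis.FluidPDE.cknC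 r z u) < ⊤) → ∃ (r₀ : ℝ) (z : ℝ × EuclideanSpace ℝ (Fin 3)) (u : ℝ → EuclideanSpace ℝ (Fin 3) → EuclideanSpace ℝ (Fin 3)) (p : ℝ → EuclideanSpace ℝ (Fin 3) → ℝ), Literature.Analysis.FluidPDE.IsLocalTypeISingularPoint r₀ z u p

-- `LocalTypeIExtraction` holds: proved by `Summit.NavierStokesRegularity.NavierStokesRegularity.Theorems.marginalTypeI_localTypeIExtraction_proof` (its module imports this route file, so no `_holds` link can be stated here).

-- earlier ABForwardMeasurable (stmt-NavierStokesRegularity-1752, replaced 2026-08-15T17:00:53Z -> stmt-NavierStokesRegularity-11302): retired by None — Literature.Analysis.FluidPDE.LocalTypeISingularityExists → ∃ (u : ℝ → EuclideanSpace ℝ (Fin 3) → EuclideanSpace ℝ (Fin 3)) (p : ℝ → EuclideanSpace ℝ (Fin 3) → ℝ) (G : ℝ → EuclideanSpace ℝ (Fin 3) → EuclideanSpace ℝ (Fin 3) →L[ℝ] EuclideanSpace ℝ (Fin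
/-- item stmt-NavierStokesRegularity-11302 · support · rank 9 · closed · proved by Summit.NavierStokesRegularity.NavierStokesRegularity.Theorems.marginalTypeI_abForwardMeasurable_proof (prover) · by planner
sources: AlbrittonBarker2019, SereginSverak2009, KNSS2009
[support, fact-level] ALBRITTON–BARKER FORWARD with measurable slices. REV 3 RESTATEMENT
(definitional, Iff.rfl with rev 1): the hypothesis
Literature.Analysis.FluidPDE.LocalTypeISingularityExists is WRITTEN OUT as ∃ r₀ z u p,
Literature.Analysis.FluidPDE.IsLocalTypeISingularPoint r₀ z u p (same reason as
LocalTypeIExtraction: the open existence statement must not be a named dependency). Content: a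
suitable weak solution with a local Type-I singular point yields a witness of
NontrivialMildAncientTypeIExists — mild bounded ancient solution of NS (ν = 1) on ℝ³ × (−∞,0),
suitable on the slab with a weak spatial gradient, not a.e. zero, Albritton–Barker 𝐈(ℝ³ × ℝ₋) < ∞ —
whose slices u t (t < 0) are moreover a.e.-strongly measurable. = the named fact
Literature.Analysis.FluidPDE.AlbrittonBarkerForward (AlbrittonBarker2019 Thm 1.1 forward direction:
Prop 2.4 + the Seregin–Šverák rescaling at an earliest singular point, SereginSverak2009 Thm 2.8;
UNPROVED in tree — needs-fact) plus the remark that the limit is a genuine KNSS mild bounded ancient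
solution, hence smooth (SereginSverak2009 Thm 2.4 / KNSS2009 §6), hence has measurable slices. The
reverse direction is proved in tree (localType -/
@[route_item "route-NavierStokesRegularity-MarginalTypeI", crux]
def ABForwardMeasurable : Prop :=
  (∃ (r₀ : ℝ) (z : ℝ × EuclideanSpace ℝ (Fin 3)) (u : ℝ → EuclideanSpace ℝ (Fin 3) → EuclideanSpace ℝ (Fin 3)) (p : ℝ → EuclideanSpace ℝ (Fin 3) → ℝ), Literature.Analysis.FluidPDE.IsLocalTypeISingularPoint r₀ z u p) → ∃ (u : ℝ → EuclideanSpace ℝ (Fin 3) → EuclideanSpace ℝ (Fin 3)) (p : ℝ → EuclideanSpace ℝ (Fin 3) → ℝ) (G : ℝ → EuclideanSpace ℝ (Fin 3) → EuclideanSpace ℝ (Fin 3) →L[ℝ] EuclideanSpace ℝ (Fin 3)), (∀ t < 0, MeasureTheory.AEStronglyMeasurable (u t) MeasureTheory.volume) ∧ Literature.Analysis.FluidPDE.IsBoundedAncientMildSolution 1 u ∧ Literature.Analysis.FluidPDE.IsSuitableWeakSolutionOn (Literature.Analysis.FluidPDE.slab (EuclideanSpace ℝ (Fin 3)) (Set.Iio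 0) isOpen_Iio) 1 0 u p ∧ Literature.Analysis.FluidPDE.HasWeakSpatialGradientOn (Literature.Analysis.FluidPDE.slab (EuclideanSpace ℝ (Fin 3)) (Set.Iio 0) isOpen_Iio) u G ∧ ¬ (Function.uncurry u =ᵐ[MeasureTheory.volume.restrict (Set.Iio (0 : ℝ) ×ˢ (Set.univ : Set (EuclideanSpace ℝ (Fin 3))))] 0) ∧ Literature.Analysis.FluidPDE.typeIBound (Set.Iio (0 : ℝ) ×ˢ (Set.univ : Set (EuclideanSpace ℝ (Fin 3)))) u p G < ⊤

-- `ABForwardMeasurable` holds: proved by `Summit.NavierStokesRegularity.NavierStokesRegularity.Theorems.marginalTypeI_abForwardMeasurable_proof` (its module imports this route file, so no `_holds` link can be stated here).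

/-- item stmt-NavierStokesRegularity-1750 · support · rank 9 · closed · proved by Summit.NavierStokesRegularity.NavierStokesRegularity.Theorems.marginalTypeI_criticalViscosityExists_proof (prover) · by planner
sources: GallagherIftimiePlanchon2003, RusinSverak2011, FujitaKato1964, Kato1984
[support] CRITICAL VISCOSITY (= the card's threshold package T1 in viscosity form): if a Clay datum
u₀ has no global Kato solution at viscosity ν then ν_c := sup{ν' ≥ ν : ¬HasGlobalKatoSolution ν' u₀}
is finite, is attained (¬HasGlobalKatoSolution ν_c u₀) and every ν' > ν_c is global. Proof: the set
is bounded by small-data global existence (fujita_kato_global_small_holds PROVED /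
kato_global_small: ‖u₀‖ ≤ δν' for ν' large) and closed because {ν' : HasGlobalKatoSolution ν' u₀} is
open — by hasGlobalKatoSolution_smul_iff this is openness of the global set along the ray A•u₀ in
L³/Ḣ^{1/2}, GallagherIftimiePlanchon2003 §3 p.1398 + Thm 3.1/3.2 (NOT in tree: cite item filed; may
be taken as a named-fact hypothesis once vendored). [sources: GallagherIftimiePlanchon2003 Thm
3.1-3.2, RusinSverak2011 §3, FujitaKato1964, Kato1984] -/
@[route_item "route-NavierStokesRegularity-MarginalTypeI", crux]
def CriticalViscosityExists : Prop :=
  ∀ ν : ℝ, 0 < ν → ∀ u₀ : EuclideanSpace ℝ (Fin 3) → EuclideanSpace ℝ (Fin 3), ContDiff ℝ (⊤ : ℕ∞) u₀ → Literature.Analysis.FluidPDE.NSWave0.IsDivFree u₀ → Literature.Analysis.FluidPDE.HasRapidSpatialDecay u₀ → ¬ Literature.Analysis.FluidPDE.HasGlobalKatoSolution ν u₀ → ∃ νc : ℝ, ν ≤ νc ∧ ¬ Literature.Analysis.FluidPDE.HasGlobalKatoSolution νc u₀ ∧ ∀ ν' : ℝ, νc < ν' → Literature.Analysis.FluidPDE.HasGlobalKatoSolution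 ν' u₀

-- `CriticalViscosityExists` holds: proved by `Summit.NavierStokesRegularity.NavierStokesRegularity.Theorems.marginalTypeI_criticalViscosityExists_proof` (its module imports this route file, so no `_holds` link can be stated here).

-- earlier Assembly (stmt-NavierStokesRegularity-1753, replaced 2026-08-15T17:00:53Z -> stmt-NavierStokesRegularity-11303): retired by None — (∀ ν : ℝ, 0 < ν → ∀ u₀ : EuclideanSpace ℝ (Fin 3) → EuclideanSpace ℝ (Fin 3), ContDiff ℝ (⊤ : ℕ∞) u₀ → Literature.Analysis.FluidPDE.NSWave0.IsDivFree u₀ → Literature.Analysis.FluidPDE.HasRapidSpatialDecay u₀ → (∀ ν' : ℝ, ν < ν' → Literature.Analysis.FluidPDE.Ha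
/-- item stmt-NavierStokesRegularity-11303 · assembly · rank 1 · closed · proved by Summit.NavierStokesRegularity.NavierStokesRegularity.Theorems.marginalTypeI_assembly_proof (prover) · by planner
[assembly] rev 3: RESTATED BY DECL NAMES as exactly the type of the deciding theorem —
MarginalBlowupTypeI → NoTypeIAncient → CriticalViscosityExists → LocalTypeIExtraction →
ABForwardMeasurable → KatoToClay → NavierStokesRegularity — and therefore PROVABLE NOW in one line
from the route file itself: `theorem … : Assembly := closes`
(Summit.NavierStokesRegularity.NavierStokesRegularity.Theses.MarginalTypeI.closes, sorry-free,
axioms propext/Classical.choice/Quot.sound). The rev-1 form inlined the five statements (and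
Literature.Analysis.FluidPDE.LocalTypeISingularityExists), which is what the textual glue lint read
as extra hypotheses. Logic: for a Clay datum either HasGlobalKatoSolution ν u₀ (KatoToClay gives the
smooth bounded-energy solution) or CriticalViscosityExists moves the same datum to ν_c ≥ ν,
MarginalBlowupTypeI gives the scaled Type-I bound there, LocalTypeIExtraction a local Type-I
singular point, ABForwardMeasurable a measurable-slice Type-I ancient witness, contradicting
NoTypeIAncient. [sources: Fefferman2000, Kato1984, AlbrittonBarker2019] [difficulty: provable-now] -/
@[route_item "route-NavierStokesRegularity-MarginalTypeI"]
def Assembly : Prop :=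
  MarginalBlowupTypeI → NoTypeIAncient → CriticalViscosityExists → LocalTypeIExtraction → ABForwardMeasurable → KatoToClay → NavierStokesRegularity

-- `Assembly` holds: proved by `Summit.NavierStokesRegularity.NavierStokesRegularity.Theorems.marginalTypeI_assembly_proof` (its module imports this route file, so no `_holds` link can be stated here).

/-! D-0027 §2.1 — DECIDING THEOREM (planner-authored via `route open/edit --closes-file`; by planner-rbadge-NavierStokesRegularity-Marginal-b79362da-g2-0 2026-08-15T17:00:53Z):
its hypotheses are this route's items and its conclusion the sub-problem Statement (glue_lint), and it elaborates with this file. -/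

@[closes "route-NavierStokesRegularity-MarginalTypeI"] theorem closes (h₁ : MarginalBlowupTypeI) (h₃ : NoTypeIAncient) (hcv : CriticalViscosityExists) (hext : LocalTypeIExtraction) (hab : ABForwardMeasurable) (hclay : KatoToClay) : _root_.NavierStokesRegularity := by
  intro ν hν u₀ hsm hdiv hdec
  by_cases hK : Literature.Analysis.FluidPDE.HasGlobalKatoSolution ν u₀
  · exact hclay ν hν u₀ hsm hdiv hdec hK
  · exfalso
    obtain ⟨νc, hle, hnot, hglob⟩ := hcv ν hν u₀ hsm hdiv hdec hK
    have hνc : 0 < νc := lt_of_lt_of_le hν hle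
    exact h₃ (hab (hext νc hνc u₀ hsm hdiv hdec hnot (h₁ νc hνc u₀ hsm hdiv hdec hglob hnot)))

end Summit.NavierStokesRegularity.NavierStokesRegularity.Theses.MarginalTypeI
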